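import Summits.BirchSwinnertonDyer.Rank1Residual.X11b.Three.ClassRecordAtThree
import Literature.NumberTheory.EllipticCurves.MatarNekovar2019.ShaIndexBoundIrreducible
import HarnessLib

/-!
# Class X11b at `p = 3` (team N8/O2 = cell `b2b-bsdres`, seat x11b3-p3, lead deal #5 (R5-4), S13):
# the (T4″)@3 CORNER — discharge of the class record's corner binders from TWO typed inputs
# (image-free STEP L at the pair; the `3`-part of BSD for its rank-0 Heegner twists) and
# Matar–Nekovář 2019 Thm. 0.3

HONEST FRAMING (verbatim, cell `b2b-bsdres`, run/shared/lean/b2b/bsd-rank1-residual/): the goal of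
the cell is to DELETE the COMBINATION-SHAPED residual classes for ALL analytic-rank `≤ 1` curves
over `ℚ` — "full BSD formula for every rank `≤ 1` curve in class `C`" assembled STRICTLY from
published theorems — so that the rank-`≤ 1` remainder becomes exactly the CONSTRUCTION-SHAPED
classes, which are TYPED (missing-input Props), NOT attempted; this is not "finishing BSD".
Team N8/O2 (X11b at `3`; RESIDUAL-MAP §I O2 OPEN). Research route; nothing booked; NO label
changes; census numbers are EVIDENCE (x11b3-p6 CORNER-CENSUS, two engines), never facts.
THEOREMS ONLY (no definition, no named fact, no `sorry`).

## The corner and its two binders in CLASS RECORD v4 / v4.1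

The (T4″)@3 corner of X11b@3 is `¬ Surj W 3` (hence `3 ∣ ord₃ Δ_min ∧ ¬Ram`,
`ClassX11b.dvd_and_not_ram_of_not_surj`): 296 class-pairs `N < 5·10⁵`, 0 TRUE-OPEN (all per-pair
closed), split(3) 129 / nonsplit(3) 167 = (C1) 88 with `3 ∤ ∏c` + (C2n) 79 with `3 ∣ ∏c`
(CORNER-CENSUS, `Ram = 0` on 296/296). In `Three.forall_bsdp_of_classRecord` (p252266) it is the two
binders `hCs` / `hCn` (`… → Typed.MissingPPartAt W 3`). Road (a) (Skinner 2016 Thm. A, (ram)) and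
road (b)'s open input `Three.StepLAt W` (whose body reads `ClassX11b W 3 → Surj W 3 → …`, so it is
VACUOUS on the corner) do not reach it.

## Kernel anatomy of the chain on the corner (this file's finding)

Route p2's chain at the odd Manin-good Hoffstein–Luo datum `(K, Dt, H, ι, P)` of a pair
(`exists_oddHeegnerData`; twist model `Wd = Cd • W^{(d_K)}`) is IMAGE-FREE except at two places,
both concerning the rank-`0` TWIST `E^{d_K}`:
* LOWER half of `E` (`missingLowerBoundAt_of_indexLowerBoundAt`) ⇐ STEP L `IndexLowerBoundAt W 3 K P`
  (⇐ the open input at the datum, `indexLowerBoundAt_of_heegner_of_openInput_prime`: control at `3`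
  is image-free) **and the twist's `≤`-half** `ord₃#Ш(E^d) + ord₃∏c(E^d) − 2·ord₃#E^d(ℚ)_tors ≤
  ord₃(L(E^d,1)/Ω)` — in print Wuthrich 2014 Prop. 21 (`ρ̄` surjective or Borel): VOID on the corner
  (`ρ̄_{E^d,3} = ρ̄_{E,3} ⊗ χ_d` is irreducible and NOT surjective);
* UPPER half of `E` (`missingUpperBoundAt_of_shaIndexBound`, `3 ∤ ∏c`) ⇐ a Kolyvagin-shape bound
  over `K`, `ord₃ #Ш(E/K) ≤ 2·ord₃ [E(K) : ℤP]` — **PUBLISHED and image-free: Matar–Nekovář 2019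
  Thm. 0.3 with §0.4, §0.11, Cor. 5.21 (e′), Prop. 5.26 (2)** (registered fact
  `MatarNekovar2019.thm03_padicValNat_card_sha_le_of_irreducible`: `Irr`, `p ≠ 2`, `d_K ≠ −3, −4`;
  the registered Cha 2005 typing is the over-`ℚ` corollary and does NOT feed this step) **and the
  twist's `≥`-half** — in print Skinner 2016 Thm. C ((irr)+(ram)): VOID (`Ram E^d ⟺ Ram E`).
So, modulo an image-free STEP L, the X11b corner at `3` IS the rank-`0` corner at the twist pair
`(E^{d_K}, 3)` — an X11a ∧ `¬Surj` pair (`r_an = 0`, `3 ‖ N`, `Irr`, `¬Ram`): the two typed inputs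
below. The sign of `E` at `3` is used NOWHERE: the same theorem serves `hCs` and `hCn`.

## What this file proves

* `exists_LOne_div_realPeriodRat_of_bsdp_rankZero` — bookkeeping: `BSD(E,p)` in analytic rank `0`
  is the display `L(E,1)/Ω = q`, `ord_p q = ord_p #Ш + ord_p ∏c − 2·ord_p #E(ℚ)_tors` (both halves).
* **`missingPPartAt_of_corner_of_inputs`** — for `(E,3) ∈` X11b with `ρ̄_{E,3}` NOT onto:
  `Typed.MissingPPartAt W 3` from the published facts Gross–Zagier, Kolyvagin (finiteness), GZK,
  modularity ×2, Hoffstein–Luo, Mazur 1978 Cor. 4.1, Poitou–Tate, local Euler characteristic,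
  **Matar–Nekovář 2019 Thm. 0.3**, and the TYPED inputs, stated INLINE at the pair (the team's
  definitions home for them is x11b3-p8's `X11b/Three/CornerResidual.lean`, deal #5 (R5-3); the
  bodies below are the proposed `Three.CornerStepLAt W` / `Three.CornerTwistAt W`):
  (L) STEP L at the odd Manin-good Heegner data of the pair, image-free [NO source at `3` — deeper
  in construction territory than road (b): Howard/Castella need a surjective or big image];
  (Tw) `BSD(E^{d_K},3)` for the rank-`0` odd Heegner twists [NO source: SU14/Skinner 2016 need
  (ram), Kato/Wuthrich 2014 need surjective-or-Borel image];
  (U♯) only if `3 ∣ ∏c(E)`: the Euler-system half `Typed.MissingUpperBoundAt W 3` (x11b3-p8's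
  Tamagawa-sharp typing `Three.CornerUpperAt`, S12).
* `missingPPartAt_of_corner_nonsplit_of_inputs` / `missingPPartAt_of_corner_split_of_inputs` — the
  instances in the exact binder types `hCn` / `hCs` of `Three.forall_bsdp_of_classRecord`.

CONDITIONAL on the typed inputs; nothing booked; O2 OPEN; X11 ∧ `r = 1` ∧ `p = 3` stays
CONSTRUCTION-SHAPED (R6.2); no label change; the corner has 0 TRUE-OPEN cells either way — this is
the binder list of the ∀-`N` class theorem, not a per-pair count.

References: [MatarNekovar2019] Thm. 0.3, §0.4, §0.11, Cor. 5.21 (e′), Prop. 5.26 (2) (JTNB 31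
(2019) pp. 456–457, 490–492); [KolyvaginEulerSystems1990] Cor. 13; [GrossZagier1986] I.(6.3), V.(2.2);
[JetchevSkinnerWan2017] §7.4.1–7.4.2; [Castella2018] Thm. 2.3, Thm. 3.2; [Wuthrich2014] Prop. 21;
[Skinner2016PacificMC] Thm. C; [HoffsteinLuo1997] §1; [Mazur1978] Cor. 4.1; [Miller2011LMS] Def. 1.1.
-/

noncomputable section

open scoped Classical

open WeierstrassCurve NumberField IsDedekindDomain Field Literature.NumberTheory.EllipticCurves
  Rat.HeightOneSpectrum
  Literature.NumberTheory.DiophantineGeometry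
  Literature.NumberTheory.EllipticCurves.GreenbergSelmer
  Literature.NumberTheory.EllipticCurves.ModularForms
  Literature.NumberTheory.EllipticCurves.Rank1Residual
  Literature.NumberTheory.EllipticCurves.Rank1Residual.Typed
  Literature.NumberTheory.EllipticCurves.Wuthrich2014
  Literature.NumberTheory.EllipticCurves.BalakrishnanEtAl2019
  Literature.NumberTheory.EllipticCurves.MatarNekovar2019
  Literature.NumberTheory.QuadraticFields.Quadratic
  Literature.NumberTheory.Automorphic
  Literature.NumberTheory.GaloisRepresentations Literature.NumberTheory.GaloisCohomology
  Summit.BirchSwinnertonDyer.Rank1Residual.X11b.AcSelmer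
  Summit.BirchSwinnertonDyer.Rank1Residual.X11b.LocBridge

namespace Summit.BirchSwinnertonDyer.Rank1Residual.X11b.Three

/-! ### §1. Bookkeeping: `BSD(E,p)` in analytic rank `0` as the leading-term display -/

/-- **`BSD(E,p)` in analytic rank `0`, unpacked**: there is `q ∈ ℚ` with `L(E,1)/Ω_E = q` and
`ord_p q = ord_p #Ш(E) + ord_p ∏_ℓ c_ℓ(E) − 2·ord_p #E(ℚ)_tors` (Miller's Def. 1.1 with `Reg = 1`,
`L^{(0)}(E,1) = L(E,1)`, `Ш` finite by GZK so `ord_p #Ш[p^∞] = ord_p #Ш`). This is the currency of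
the twist inputs `htw` of `missingLowerBoundAt_of_indexLowerBoundAt` (`≤`) and
`missingUpperBoundAt_of_shaIndexBound` (`≥`). Bookkeeping. [cite: Miller2011LMS, §1 and Def. 1.1 (arXiv:1010.2431 p. 3)] -/
theorem exists_LOne_div_realPeriodRat_of_bsdp_rankZero
    (hGZK : rank_eq_analyticRank_of_analyticRank_le_one) (hmod : hasEntireLFunction_rat)
    (V : WeierstrassCurve ℚ) [V.IsElliptic] [V.IsGloballyMinimal] (p : ℕ) [Fact p.Prime]
    (hr : V.analyticRank = 0) (h : BSDp V p) :
    ∃ q : ℚ, V.entireLFunction 1 / (V.realPeriodRat : ℂ) = (q : ℂ) ∧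
      padicValRat p q = (padicValNat p V.shaOrder : ℤ) + padicValNat p V.tamagawaProduct -
        2 * padicValNat p V.torsionOrder := by
  obtain ⟨hrank, _, s, hs, hv⟩ := h
  haveI : Finite V.sha := (hGZK V (by omega)).2
  have hmw : V.mordellWeilRank = 0 := by omega
  have hΩ : (V.realPeriodRat : ℂ) ≠ 0 := by exact_mod_cast V.realPeriodRat_pos_holds.ne'
  have hc : (V.tamagawaProduct : ℂ) ≠ 0 := by exact_mod_cast V.tamagawaProduct_pos_holds.ne'
  have ht : (V.torsionOrder : ℂ) ≠ 0 := by exact_mod_cast V.torsionOrder_pos_holds.ne'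
  have hL : V.leadingLCoeff = V.entireLFunction 1 := leadingLCoeff_eq_of_analyticRank_eq_zero V hr
  -- `L(1) · #tors² = s · Ω · ∏c`
  have hs' : V.entireLFunction 1 * (V.torsionOrder : ℂ) ^ 2 =
      (s : ℂ) * ((V.realPeriodRat : ℂ) * (V.tamagawaProduct : ℂ)) := by
    have h1 := hs
    rw [shaAn_def, hL, V.regulator_eq_one_of_rank_zero hmw, Complex.ofReal_one, mul_one,
      div_eq_iff (mul_ne_zero hΩ hc)] at h1
    rw [h1]
  -- `s ≠ 0` since `L(E,1) ≠ 0`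
  have hL0 : V.entireLFunction 1 ≠ 0 := hL ▸ V.leadingLCoeff_ne_zero_holds (hmod V)
  have hs0 : s ≠ 0 := by
    rintro rfl
    apply mul_ne_zero hL0 (pow_ne_zero 2 ht)
    rw [hs']; simp
  have ht' : (V.torsionOrder : ℚ) ≠ 0 := by exact_mod_cast V.torsionOrder_pos_holds.ne'
  have hc' : (V.tamagawaProduct : ℚ) ≠ 0 := by exact_mod_cast V.tamagawaProduct_pos_holds.ne'
  refine ⟨s * (V.tamagawaProduct : ℚ) / (V.torsionOrder : ℚ) ^ 2, ?_, ?_⟩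
  · rw [div_eq_iff hΩ]
    push_cast
    rw [div_mul_eq_mul_div, eq_div_iff (pow_ne_zero 2 ht), hs']
    ring
  · rw [padicValRat.div (mul_ne_zero hs0 hc') (pow_ne_zero 2 ht'), padicValRat.mul hs0 hc',
      padicValRat.pow (V.torsionOrder : ℚ), padicValRat.of_nat, padicValRat.of_nat, hv,
      WeierstrassCurve.shaOrder, padicValNat_card_addPrimaryComponent]
    push_cast
    ring

/-! ### §2. The corner from its two typed inputs and Matar–Nekovář 2019 -/

/-- **THE (T4″)@3 CORNER OF X11b FROM TWO TYPED INPUTS (image-free chain).** For `(E,3) ∈` X11b with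
`ρ̄_{E,3}` NOT surjective: `ord₃ #Ш(E) = ord₃ #Ш(E)_an` (`Typed.MissingPPartAt W 3`) from the
PUBLISHED facts Gross–Zagier (`hGZ`), Kolyvagin finiteness (`hKo`), GZK, modularity (`hmod`, `hnf`),
Hoffstein–Luo (`hHL`), Mazur 1978 Cor. 4.1 (`hMaz`), Poitou–Tate (`hPT`), local Euler characteristic
(`hEP`), **Matar–Nekovář 2019 Thm. 0.3** (`hMN`: Kolyvagin's `K`-bound under irreducibility ONLY —
`d_K ≠ −3` from `3 ∤ d_K`, `d_K ≠ −4` from `d_K` odd), Néron scaling (theorem), and the TYPED inputs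
at the pair: `hL` = STEP L at every odd Manin-good Heegner datum of the pair, image-free [NO source
at `3`]; `hTw` = `BSD(E^{d_K},3)` for the rank-`0` odd Heegner twists [NO source: the twist pair is
X11a@3 ∧ `¬Surj`; SU14/Skinner 2016 need (ram), Kato/Wuthrich need surjective-or-Borel]; `hU` = the
Euler-system half when `3 ∣ ∏c(E)` [x11b3-p8's Tamagawa-sharp typing]. Chain: `exists_oddHeegnerData`;
lower = `missingLowerBoundAt_of_indexLowerBoundAt` ∘ `indexLowerBoundAt_of_heegner_of_openInput_prime`
with the twist's `≤`-half from `hTw`; upper (`3 ∤ ∏c`) = `missingUpperBoundAt_of_shaIndexBound` with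
the twist's `≥`-half from `hTw` and the `K`-bound from `hMN`. The sign of `E` at `3` is not used.
CONDITIONAL on the typed inputs; nothing booked; O2 OPEN; no label change.
[cite: MatarNekovar2019, Thm. 0.3 (p. 456), §0.4, §0.11 (p. 457), Cor. 5.21 (e′), Prop. 5.26 (2)]
[cite: JetchevSkinnerWan2017, §7.4.1–7.4.2 (pp. 30–31)] [cite: Castella2018, Thm. 2.3 (p. 5), Thm. 3.2 (p. 9)]
[cite: HoffsteinLuo1997, Theorem (§1)] [cite: Mazur1978, Cor. 4.1] [cite: Miller2011LMS, Def. 1.1] -/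
theorem missingPPartAt_of_corner_of_inputs [Fact (Nat.Prime 3)]
    (hGZ : ∀ (N : ℕ) [NeZero N] (W : WeierstrassCurve ℚ) (K : Type) [Field K] [NumberField K],
      gross_zagier N W K)
    (hKo : ∀ (N : ℕ) [NeZero N] (W : WeierstrassCurve ℚ) (K : Type) [Field K] [NumberField K],
      kolyvagin N W K)
    (hGZK : rank_eq_analyticRank_of_analyticRank_le_one) (hmod : hasEntireLFunction_rat)
    (hnf : exists_isNewformOf) (hHL : HoffsteinLuo1997_exists_twist_L_one_ne_zero)
    (hMaz : mazur_not_dvd_maninConstant_of_odd)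
    (hPT : ∀ (K : Type) [Field K] [NumberField K], poitouTate_sum_localTatePairing_eq_zero K)
    (hEP : ∀ (K : Type) [Field K] [NumberField K] (v : HeightOneSpectrum (𝓞 K)),
      localEulerPoincareCharacteristic (v.adicCompletion K))
    (hMN : ∀ (N : ℕ) [NeZero N] (W : WeierstrassCurve ℚ) (K : Type) [Field K] [NumberField K],
      thm03_padicValNat_card_sha_le_of_irreducible N W K)
    (W : WeierstrassCurve ℚ) [W.IsElliptic] [W.IsGloballyMinimal] (hX : ClassX11b W 3)
    (hns : ¬ Surj W 3)
    -- (L) STEP L at the odd Manin-good Heegner data of the pair, image-free — NO source at `3`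
    (hL : ∀ (N : ℕ) [NeZero N] (K : Type) [Field K] [NumberField K]
      (Dt : ModularParametrizationData W N) (H : HeegnerDatum N (NumberField.discr K)) (ι : K →+* ℂ)
      (P : (W.baseChange K).toAffine.Point),
      ClassX11b W 3 → ¬ Surj W 3 → W.conductorNorm ℤ = N → IsImaginaryQuadratic K →
      Odd (NumberField.discr K) → SatisfiesHeegnerHypothesis N K →
      (W.quadraticTwist (NumberField.discr K : ℚ)).entireLFunction 1 ≠ 0 →
      WeierstrassCurve.Affine.Point.map ι.toRatAlgHom P = heegnerPointComplex Dt H →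
      ¬ (3 : ℤ) ∣ Dt.c → ¬ IsOfFinAddOrder P →
      ∀ (κ : ZpExtension K 3), κ.IsAnticyclotomic →
        ∀ (γ : Field.absoluteGaloisGroup K) [Fact (κ.IsTopGenerator γ)]
          (𝔭 : HeightOneSpectrum (𝓞 K)) (h𝔭 : ((3 : ℕ) : 𝓞 K) ∈ 𝔭.asIdeal)
          (he : 𝔭.asIdeal.ramificationIdx (𝓞 ℚ) = 1) (hf : 𝔭.asIdeal.inertiaDeg (𝓞 ℚ) = 1),
          IMCLowerWaldspurgerOnTreeAt 3 κ 𝔭 γ (embAt K 3 𝔭 h𝔭 he hf) P)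
    -- (Tw) `BSD(E^{d_K},3)` for the rank-0 odd Heegner twists of the pair — NO source
    (hTw : ∀ (K : Type) [Field K] [NumberField K] (Wd : WeierstrassCurve ℚ) [Wd.IsElliptic]
      [Wd.IsGloballyMinimal] (Cd : VariableChange ℚ),
      ClassX11b W 3 → ¬ Surj W 3 → IsImaginaryQuadratic K → Odd (NumberField.discr K) →
      SatisfiesHeegnerHypothesis (W.conductorNorm ℤ) K →
      (W.quadraticTwist (NumberField.discr K : ℚ)).entireLFunction 1 ≠ 0 →
      Cd • W.quadraticTwist (NumberField.discr K : ℚ) = Wd → BSDp Wd 3)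
    -- (U♯) the Euler-system half when `3 ∣ ∏c(E)` (Tamagawa-sharp typing, x11b3-p8)
    (hU : 3 ∣ W.tamagawaProduct → Typed.MissingUpperBoundAt W 3) :
    Typed.MissingPPartAt W 3 := by
  have hX' := hX
  obtain ⟨hr, hp2, hmult, hirr⟩ := hX
  haveI : NeZero (W.conductorNorm ℤ) := ⟨(W.conductorNorm_pos_holds).ne'⟩
  obtain ⟨K, _, _, Dt, H, ι, P, Wd, _, _, Cd, hK, hodd, hpd, hHN, hP, hc, hμ, hLt, hWd⟩ :=
    exists_oddHeegnerData hnf hHL hMaz integral_neronScaling_of_isGloballyMinimal_holds W 3 hr hp2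
      hmult hirr
  -- transports to the minimal twist model (image-free)
  have hD0 : (NumberField.discr K : ℚ) ≠ 0 := by exact_mod_cast NumberField.discr_ne_zero K
  haveI hEt : (W.quadraticTwist (NumberField.discr K : ℚ)).IsElliptic :=
    W.isElliptic_quadraticTwist hD0
  have htam : padicValNat 3 Wd.tamagawaProduct = padicValNat 3 W.tamagawaProduct :=
    X2.padicValNat_tamagawaProduct_twist_of_heegner_of_odd W 3 hp2 K hK hodd hpd hHN Cd hWd
  have hu : padicValRat 3 (Cd.u : ℚ) = 0 :=
    padicValRat_u_eq_zero_of_twist_minimal W 3 K hK hHN hmult Cd hWd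
  have hLt' : (W.quadraticTwist (NumberField.discr K : ℚ)).entireLFunction = Wd.entireLFunction := by
    rw [← hWd, entireLFunction_smul]
  have hLd1 : Wd.entireLFunction 1 ≠ 0 := by rw [← hLt']; exact hLt
  have hrd : Wd.analyticRank = 0 := (Wd.analyticRank_eq_zero_iff_holds (hmod Wd)).2 hLd1
  -- the twist's `3`-part from the typed input (Tw), both halves
  obtain ⟨qd, hqd, hvqd⟩ := exists_LOne_div_realPeriodRat_of_bsdp_rankZero hGZK hmod Wd 3 hrd
    (hTw K Wd Cd hX' hns hK hodd hHN hLt hWd)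
  -- the Heegner point has infinite order (Gross–Zagier, `L'(E,1) ≠ 0`, `L(E^D,1) ≠ 0`)
  have hPinf : ¬ IsOfFinAddOrder P :=
    not_isOfFinAddOrder_of_heegner_of_analyticRank_eq_one W _ K Dt H ι P (hGZ _ W K) hmod hr hK hHN
      hLt hP
  refine Typed.missingPPartAt_of_lower_of_upper W 3 ?_ ?_
  · -- LOWER half: STEP L from (L) at the datum + the twist's `≤`-half
    exact missingLowerBoundAt_of_indexLowerBoundAt W 3 (W.conductorNorm ℤ) K Dt H ι P (hGZ _ W K)
      (hKo _ W K) hGZK hmod hK hHN hP hp2 hc hμ hr hLt Wd Cd hWd hu htam ⟨qd, hqd, hvqd.symm.le⟩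
      (fun _ ↦ indexLowerBoundAt_of_heegner_of_openInput_prime W 3 _ K Dt H ι P (hGZ _ W K) hKo
        hmod hPT hEP hr hmult hirr rfl hK hHN hLt hP
        (hL _ K Dt H ι P hX' hns rfl hK hodd hHN hLt hP hc hPinf))
  · -- UPPER half: Tamagawa-sharp input if `3 ∣ ∏c`, else Matar–Nekovář + the twist's `≥`-half
    by_cases ht : 3 ∣ W.tamagawaProduct
    · exact hU ht
    · have hD3 : NumberField.discr K ≠ -3 := by
        intro h; apply hpd; rw [h]; exact ⟨-1, by norm_num⟩
      have hD4 : NumberField.discr K ≠ -4 := by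
        intro h; have := Int.odd_iff.mp hodd; omega
      exact missingUpperBoundAt_of_shaIndexBound W 3 (W.conductorNorm ℤ) K Dt H ι P (hGZ _ W K)
        (hKo _ W K) hGZK hmod hK hHN hP hp2 hc hμ hr hLt Wd Cd hWd hu htam ht ⟨qd, hqd, hvqd.le⟩
        (fun _ hnt ↦ hMN _ W K hK hHN hD3 hD4 ⟨Dt, H, ι, hP⟩ hnt Nat.prime_three (by decide) hirr)

/-! ### §3. The instances in the class record's binder types -/

/-- **`hCn` of `Three.forall_bsdp_of_classRecord` (corner ∧ nonsplit(3): 167 class-pairs = (C1) 88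
`3 ∤ ∏c` + (C2n) 79 `3 ∣ ∏c`; 0 TRUE-OPEN) from the two typed corner inputs, the Tamagawa-sharp
upper input on (C2n), and Matar–Nekovář 2019** — `missingPPartAt_of_corner_of_inputs` read in the
binder's exact type (the antecedents `3 ∣ ord₃ Δ_min`, `¬Ram`, nonsplit are not used by the chain).
CONDITIONAL; nothing booked. [cite: MatarNekovar2019, Thm. 0.3 (p. 456) and §0.11 (p. 457)]
[cite: Miller2011LMS, Def. 1.1] -/
theorem missingPPartAt_of_corner_nonsplit_of_inputs [Fact (Nat.Prime 3)]
    (hGZ : ∀ (N : ℕ) [NeZero N] (W : WeierstrassCurve ℚ) (K : Type) [Field K] [NumberField K],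
      gross_zagier N W K)
    (hKo : ∀ (N : ℕ) [NeZero N] (W : WeierstrassCurve ℚ) (K : Type) [Field K] [NumberField K],
      kolyvagin N W K)
    (hGZK : rank_eq_analyticRank_of_analyticRank_le_one) (hmod : hasEntireLFunction_rat)
    (hnf : exists_isNewformOf) (hHL : HoffsteinLuo1997_exists_twist_L_one_ne_zero)
    (hMaz : mazur_not_dvd_maninConstant_of_odd)
    (hPT : ∀ (K : Type) [Field K] [NumberField K], poitouTate_sum_localTatePairing_eq_zero K)
    (hEP : ∀ (K : Type) [Field K] [NumberField K] (v : HeightOneSpectrum (𝓞 K)),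
      localEulerPoincareCharacteristic (v.adicCompletion K))
    (hMN : ∀ (N : ℕ) [NeZero N] (W : WeierstrassCurve ℚ) (K : Type) [Field K] [NumberField K],
      thm03_padicValNat_card_sha_le_of_irreducible N W K)
    -- (L) image-free STEP L on the corner
    (hL : ∀ (W : WeierstrassCurve ℚ) [W.IsElliptic] [W.IsGloballyMinimal]
      (N : ℕ) [NeZero N] (K : Type) [Field K] [NumberField K]
      (Dt : ModularParametrizationData W N) (H : HeegnerDatum N (NumberField.discr K)) (ι : K →+* ℂ)
      (P : (W.baseChange K).toAffine.Point),
      ClassX11b W 3 → ¬ Surj W 3 → W.conductorNorm ℤ = N → IsImaginaryQuadratic K →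
      Odd (NumberField.discr K) → SatisfiesHeegnerHypothesis N K →
      (W.quadraticTwist (NumberField.discr K : ℚ)).entireLFunction 1 ≠ 0 →
      WeierstrassCurve.Affine.Point.map ι.toRatAlgHom P = heegnerPointComplex Dt H →
      ¬ (3 : ℤ) ∣ Dt.c → ¬ IsOfFinAddOrder P →
      ∀ (κ : ZpExtension K 3), κ.IsAnticyclotomic →
        ∀ (γ : Field.absoluteGaloisGroup K) [Fact (κ.IsTopGenerator γ)]
          (𝔭 : HeightOneSpectrum (𝓞 K)) (h𝔭 : ((3 : ℕ) : 𝓞 K) ∈ 𝔭.asIdeal)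
          (he : 𝔭.asIdeal.ramificationIdx (𝓞 ℚ) = 1) (hf : 𝔭.asIdeal.inertiaDeg (𝓞 ℚ) = 1),
          IMCLowerWaldspurgerOnTreeAt 3 κ 𝔭 γ (embAt K 3 𝔭 h𝔭 he hf) P)
    -- (Tw) `BSD(E^{d_K},3)` for the rank-0 odd Heegner twists of corner pairs
    (hTw : ∀ (W : WeierstrassCurve ℚ) [W.IsElliptic] [W.IsGloballyMinimal]
      (K : Type) [Field K] [NumberField K] (Wd : WeierstrassCurve ℚ) [Wd.IsElliptic]
      [Wd.IsGloballyMinimal] (Cd : VariableChange ℚ),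
      ClassX11b W 3 → ¬ Surj W 3 → IsImaginaryQuadratic K → Odd (NumberField.discr K) →
      SatisfiesHeegnerHypothesis (W.conductorNorm ℤ) K →
      (W.quadraticTwist (NumberField.discr K : ℚ)).entireLFunction 1 ≠ 0 →
      Cd • W.quadraticTwist (NumberField.discr K : ℚ) = Wd → BSDp Wd 3)
    -- (U♯) the Euler-system half on corner ∧ `3 ∣ ∏c` (Tamagawa-sharp typing, x11b3-p8)
    (hCU : ∀ (W : WeierstrassCurve ℚ) [W.IsElliptic] [W.IsGloballyMinimal],
      ClassX11b W 3 → ¬ Surj W 3 → 3 ∣ W.tamagawaProduct → Typed.MissingUpperBoundAt W 3) :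
    ∀ (W : WeierstrassCurve ℚ) [W.IsElliptic] [W.IsGloballyMinimal],
      ClassX11b W 3 → ¬ Surj W 3 → 3 ∣ padicValInt 3 W.minimalDiscriminantInt → ¬ Ram W 3 →
        ¬ W.HasSplitMultiplicativeReductionAtPrime 3 → Typed.MissingPPartAt W 3 :=
  fun W _ _ hX hns _ _ _ ↦
    missingPPartAt_of_corner_of_inputs hGZ hKo hGZK hmod hnf hHL hMaz hPT hEP hMN W hX hns (hL W)
      (hTw W) (hCU W hX hns)

/-- **`hCs` of `Three.forall_bsdp_of_classRecord` (corner ∧ split(3): 129 class-pairs, 0 TRUE-OPEN;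
there `c₃ = ord₃ Δ_min ≥ 3` is divisible by `3`, so the Tamagawa-sharp input is always drawn) from
the same inputs** — the chain does not see the sign at `3`. x11b3-p8's S12 file types the inputs
(`Three.CornerStepLAt` / `Three.CornerTwistAt` / `Three.CornerUpperAt`, deal #5 (R5-3)); this is the
discharge in the binder's exact type. CONDITIONAL; nothing booked.
[cite: MatarNekovar2019, Thm. 0.3 (p. 456) and §0.11 (p. 457)] [cite: Miller2011LMS, Def. 1.1] -/
theorem missingPPartAt_of_corner_split_of_inputs [Fact (Nat.Prime 3)]
    (hGZ : ∀ (N : ℕ) [NeZero N] (W : WeierstrassCurve ℚ) (K : Type) [Field K] [NumberField K],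
      gross_zagier N W K)
    (hKo : ∀ (N : ℕ) [NeZero N] (W : WeierstrassCurve ℚ) (K : Type) [Field K] [NumberField K],
      kolyvagin N W K)
    (hGZK : rank_eq_analyticRank_of_analyticRank_le_one) (hmod : hasEntireLFunction_rat)
    (hnf : exists_isNewformOf) (hHL : HoffsteinLuo1997_exists_twist_L_one_ne_zero)
    (hMaz : mazur_not_dvd_maninConstant_of_odd)
    (hPT : ∀ (K : Type) [Field K] [NumberField K], poitouTate_sum_localTatePairing_eq_zero K)
    (hEP : ∀ (K : Type) [Field K] [NumberField K] (v : HeightOneSpectrum (𝓞 K)),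
      localEulerPoincareCharacteristic (v.adicCompletion K))
    (hMN : ∀ (N : ℕ) [NeZero N] (W : WeierstrassCurve ℚ) (K : Type) [Field K] [NumberField K],
      thm03_padicValNat_card_sha_le_of_irreducible N W K)
    (hL : ∀ (W : WeierstrassCurve ℚ) [W.IsElliptic] [W.IsGloballyMinimal]
      (N : ℕ) [NeZero N] (K : Type) [Field K] [NumberField K]
      (Dt : ModularParametrizationData W N) (H : HeegnerDatum N (NumberField.discr K)) (ι : K →+* ℂ)
      (P : (W.baseChange K).toAffine.Point),
      ClassX11b W 3 → ¬ Surj W 3 → W.conductorNorm ℤ = N → IsImaginaryQuadratic K →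
      Odd (NumberField.discr K) → SatisfiesHeegnerHypothesis N K →
      (W.quadraticTwist (NumberField.discr K : ℚ)).entireLFunction 1 ≠ 0 →
      WeierstrassCurve.Affine.Point.map ι.toRatAlgHom P = heegnerPointComplex Dt H →
      ¬ (3 : ℤ) ∣ Dt.c → ¬ IsOfFinAddOrder P →
      ∀ (κ : ZpExtension K 3), κ.IsAnticyclotomic →
        ∀ (γ : Field.absoluteGaloisGroup K) [Fact (κ.IsTopGenerator γ)]
          (𝔭 : HeightOneSpectrum (𝓞 K)) (h𝔭 : ((3 : ℕ) : 𝓞 K) ∈ 𝔭.asIdeal)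
          (he : 𝔭.asIdeal.ramificationIdx (𝓞 ℚ) = 1) (hf : 𝔭.asIdeal.inertiaDeg (𝓞 ℚ) = 1),
          IMCLowerWaldspurgerOnTreeAt 3 κ 𝔭 γ (embAt K 3 𝔭 h𝔭 he hf) P)
    (hTw : ∀ (W : WeierstrassCurve ℚ) [W.IsElliptic] [W.IsGloballyMinimal]
      (K : Type) [Field K] [NumberField K] (Wd : WeierstrassCurve ℚ) [Wd.IsElliptic]
      [Wd.IsGloballyMinimal] (Cd : VariableChange ℚ),
      ClassX11b W 3 → ¬ Surj W 3 → IsImaginaryQuadratic K → Odd (NumberField.discr K) →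
      SatisfiesHeegnerHypothesis (W.conductorNorm ℤ) K →
      (W.quadraticTwist (NumberField.discr K : ℚ)).entireLFunction 1 ≠ 0 →
      Cd • W.quadraticTwist (NumberField.discr K : ℚ) = Wd → BSDp Wd 3)
    (hCU : ∀ (W : WeierstrassCurve ℚ) [W.IsElliptic] [W.IsGloballyMinimal],
      ClassX11b W 3 → ¬ Surj W 3 → 3 ∣ W.tamagawaProduct → Typed.MissingUpperBoundAt W 3) :
    ∀ (W : WeierstrassCurve ℚ) [W.IsElliptic] [W.IsGloballyMinimal],
      ClassX11b W 3 → ¬ Surj W 3 → 3 ∣ padicValInt 3 W.minimalDiscriminantInt → ¬ Ram W 3 →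
        W.HasSplitMultiplicativeReductionAtPrime 3 → Typed.MissingPPartAt W 3 :=
  fun W _ _ hX hns _ _ _ ↦
    missingPPartAt_of_corner_of_inputs hGZ hKo hGZK hmod hnf hHL hMaz hPT hEP hMN W hX hns (hL W)
      (hTw W) (hCU W hX hns)

end Summit.BirchSwinnertonDyer.Rank1Residual.X11b.Three

end
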